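import Literature.Analysis.PDE.EvansKrylovOscillationAux
import HarnessLib

/-!
# The Evans–Krylov oscillation decay: the steps (Gilbarg–Trudinger (17.49)–(17.51))

The three ingredients of GT's derivation of `ω(αR) ≤ δ ω(R) + C(εω(R) + D₁R + f₀R²)` on
p. 479–480, isolated with clean interfaces:

* `setLIntegral_rpow_sup_sub_le` — **(17.49)** for one direction `k`: the weak Harnack
  inequality for `W_k - w_k`, `w_k = h_k + ε Σ_l h_l²`, compared with `M_k - h_k` from below and
  with `M_k - sup_{B_{αR}} h_k + 2εω` from above (passing to the supremum by continuity);
* `osc_add_two_mul_le_pointwise` — **(17.50)–(17.51)** pointwise: the coupling inequality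
  `Σ_k β_k (h_k(y) - h_k(x)) ≤ D₁R`, `λ* ≤ β ≤ Λ*`, bounds `h_l(y) - inf_B h_l`, whence
  `osc_B h_l + 2N ≤ c₁ (D₁R + N + Σ_k (M_k - h_k(y) + N))`;
* `oscillation_decay_algebra` — the final real-number bookkeeping (power means and `p`-th roots),
  and `volume_ball_toReal` for `|B_r| = rⁿ|B₁|`.

## References

* D. Gilbarg, N. S. Trudinger, *Elliptic Partial Differential Equations of Second Order* (2001),
  §17.4, (17.49)–(17.51). [GilbargTrudinger2001]
-/

noncomputable section

open Set InnerProductSpace Matrix Filter Metric MeasureTheory WithLp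
open scoped Topology ENNReal RealInnerProductSpace

namespace Literature.Analysis.PDE.EvansKrylov

open Literature.Analysis.PDE.ABP Literature.Analysis.PDE.KrylovSafonov

variable {ι : Type*} [Fintype ι] [DecidableEq ι]

/-- **(17.49) for one direction.** For `[m_l, M_l]`-valued (`⊆ [0,1]`) functions `h_l` on
`B̄_R(y₀)` with `w_k = h_k + ε Σ_l h_l²` a supersolution (`a : D²w_k ≥ -f₀`), `N > 0`,
`N ≥ R²f₀/λ`:
`∫_{B_{αR}} (M_k - h_k + N)^p ≤ C Rⁿ (M_k - sup_{B_{αR}} h_k + 2ε Σ_l (M_l - m_l) + N)^p`.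
[cite: GilbargTrudinger2001, §17.4, (17.49)] -/
theorem setLIntegral_rpow_sup_sub_le [Nonempty ι] {K : Type*} [Fintype K]
    {U : Set (EuclideanSpace ℝ ι)} (hU : IsOpen U) {y₀ : EuclideanSpace ℝ ι} {R : ℝ} (hR : 0 < R)
    (hBU : closedBall y₀ R ⊆ U) {a : EuclideanSpace ℝ ι → Matrix ι ι ℝ}
    (ha : ∀ y ∈ ball y₀ R, (a y).IsSymm) {lam Λ : ℝ} (hlam0 : 0 < lam) (hΛlam : lam ≤ Λ)
    (hlam : ∀ y ∈ ball y₀ R, ∀ ξ : ι → ℝ, lam * (ξ ⬝ᵥ ξ) ≤ ξ ⬝ᵥ (a y *ᵥ ξ))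
    (hΛ : ∀ y ∈ ball y₀ R, ∀ ξ : ι → ℝ, ξ ⬝ᵥ (a y *ᵥ ξ) ≤ Λ * (ξ ⬝ᵥ ξ))
    {h : K → EuclideanSpace ℝ ι → ℝ} (hh : ∀ k, ContDiffOn ℝ 2 (h k) U)
    (hhm : ∀ k, Measurable (h k)) {M m : K → ℝ}
    (hMm : ∀ k, ∀ y ∈ closedBall y₀ R, m k ≤ h k y ∧ h k y ≤ M k) (hm0 : ∀ k, 0 ≤ m k)
    (hM1 : ∀ k, M k ≤ 1) {ε : ℝ} (hε : 0 ≤ ε) {f₀ : ℝ} (hf₀ : 0 ≤ f₀)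
    (hsup : ∀ k, ∀ y ∈ ball y₀ R, -f₀ ≤ pair (a y) (hessianMatrix
      (fun x ↦ h k x + ε * ∑ l, h l x ^ 2) (EuclideanSpace.basisFun ι ℝ) y))
    {N : ℝ} (hN0 : 0 < N) (hNf : R ^ 2 * f₀ / lam ≤ N) (k : K) :
    ∫⁻ y in ball y₀ (alphaWH ι * R), ENNReal.ofReal ((M k - h k y + N) ^ pWH ι (Λ / lam)) ≤
      ENNReal.ofReal (CWH ι (Λ / lam) * R ^ Fintype.card ι *
        (M k - sSup (h k '' ball y₀ (alphaWH ι * R)) + 2 * ε * ∑ l, (M l - m l) + N) ^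
          pWH ι (Λ / lam)) := by
  set α := alphaWH ι with hα
  set p := pWH ι (Λ / lam) with hp
  set n := Fintype.card ι with hn
  set CW := CWH ι (Λ / lam) with hCW
  have hratio : 0 ≤ Λ / lam := div_nonneg (hlam0.le.trans hΛlam) hlam0.le
  have hp0 : 0 < p := pWH_pos hratio
  have hCW0 : 0 ≤ CW := (CWH_pos hratio).le
  obtain ⟨hα0, hα1, -⟩ := alphaWH_bounds (ι := ι)
  have hαR : 0 < α * R := mul_pos hα0 hR
  have hαR' : α * R ≤ R := by nlinarith
  have hballs : ball y₀ (α * R) ⊆ closedBall y₀ R :=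
    ball_subset_closedBall.trans (closedBall_subset_closedBall hαR')
  set w : EuclideanSpace ℝ ι → ℝ := fun x ↦ h k x + ε * ∑ l, h l x ^ 2 with hw
  set W : ℝ := M k + ε * ∑ l, M l ^ 2 with hWdef
  have hwc : ContDiffOn ℝ 2 w U :=
    (hh k).add (contDiffOn_const.mul (ContDiffOn.sum fun l _ ↦ (hh l).pow 2))
  have hwm : Measurable w :=
    (hhm k).add (measurable_const.mul (Finset.measurable_sum _ fun l _ ↦ (hhm l).pow_const 2))
  have hsq : ∀ y ∈ closedBall y₀ R, ∀ l,
      h l y ^ 2 ≤ M l ^ 2 ∧ M l ^ 2 - h l y ^ 2 ≤ 2 * (M l - m l) := by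
    intro y hy l
    obtain ⟨h1, h2⟩ := hMm l y hy
    have := hm0 l
    have := hM1 l
    constructor <;> nlinarith
  have hsum1 : ∀ y ∈ closedBall y₀ R, ∑ l, h l y ^ 2 ≤ ∑ l, M l ^ 2 := fun y hy ↦
    Finset.sum_le_sum fun l _ ↦ (hsq y hy l).1
  have hsum2 : ∀ y ∈ closedBall y₀ R, ∑ l, M l ^ 2 - ∑ l, h l y ^ 2 ≤ 2 * ∑ l, (M l - m l) :=
    fun y hy ↦ by
      rw [← Finset.sum_sub_distrib, Finset.mul_sum]
      exact Finset.sum_le_sum fun l _ ↦ (hsq y hy l).2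
  have hW : ∀ y ∈ closedBall y₀ R, w y ≤ W := fun y hy ↦ by
    have h1 := (hMm k y hy).2
    have h2 := mul_le_mul_of_nonneg_left (hsum1 y hy) hε
    simp only [hw, hWdef]
    linarith
  -- weak Harnack for `W - w`
  have hWH : ∀ x ∈ ball y₀ (α * R), ∫⁻ y in ball y₀ (α * R), ENNReal.ofReal ((W - w y + N) ^ p) ≤
      ENNReal.ofReal (CW * R ^ n * (W - w x + N) ^ p) := fun x hx ↦
    weakHarnack_const_sub hU hR hBU hwc hwm hW hf₀ ha hlam0 hlam hΛ (hsup k) hN0 hNf hx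
  -- compare with `M_k - h_k`
  have hlow : ∀ x ∈ ball y₀ (α * R),
      ∫⁻ y in ball y₀ (α * R), ENNReal.ofReal ((M k - h k y + N) ^ p) ≤
        ENNReal.ofReal (CW * R ^ n * (M k - h k x + 2 * ε * ∑ l, (M l - m l) + N) ^ p) := by
    intro x hx
    have hxc := hballs hx
    calc ∫⁻ y in ball y₀ (α * R), ENNReal.ofReal ((M k - h k y + N) ^ p)
        ≤ ∫⁻ y in ball y₀ (α * R), ENNReal.ofReal ((W - w y + N) ^ p) := by
          refine setLIntegral_mono' measurableSet_ball fun y hy ↦ ?_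
          have hyc := hballs hy
          have h1 : M k - h k y ≤ W - w y := by
            have h2 := mul_le_mul_of_nonneg_left (hsum1 y hyc) hε
            simp only [hw, hWdef]
            linarith
          have h0 : 0 ≤ M k - h k y + N := by linarith [(hMm k y hyc).2]
          exact ENNReal.ofReal_le_ofReal (Real.rpow_le_rpow h0 (by linarith) hp0.le)
      _ ≤ ENNReal.ofReal (CW * R ^ n * (W - w x + N) ^ p) := hWH x hx
      _ ≤ ENNReal.ofReal (CW * R ^ n * (M k - h k x + 2 * ε * ∑ l, (M l - m l) + N) ^ p) := by
          have h1 : W - w x ≤ M k - h k x + 2 * ε * ∑ l, (M l - m l) := by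
            have h2 := mul_le_mul_of_nonneg_left (hsum2 x hxc) hε
            simp only [hw, hWdef]
            linarith
          have h0 : 0 ≤ W - w x + N := by linarith [hW x hxc]
          exact ENNReal.ofReal_le_ofReal (mul_le_mul_of_nonneg_left
            (Real.rpow_le_rpow h0 (by linarith) hp0.le) (by positivity))
  -- pass to the supremum of `h_k` over the small ball
  have hS : (h k '' ball y₀ (α * R)).Nonempty := ⟨_, mem_image_of_mem _ (mem_ball_self hαR)⟩
  have hSb : BddAbove (h k '' ball y₀ (α * R)) :=
    ⟨M k, by rintro _ ⟨y, hy, rfl⟩; exact (hMm k y (hballs hy)).2⟩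
  have hF : Continuous fun t : ℝ ↦
      ENNReal.ofReal (CW * R ^ n * (M k - t + 2 * ε * ∑ l, (M l - m l) + N) ^ p) :=
    ENNReal.continuous_ofReal.comp (continuous_const.mul
      ((((continuous_const.sub continuous_id).add continuous_const).add continuous_const).rpow_const
        fun _ ↦ Or.inr hp0.le))
  exact le_apply_csSup_of_forall hS hSb hF (by rintro _ ⟨x, hx, rfl⟩; exact hlow x hx)

/-- **(17.50)–(17.51), pointwise.** From the coupling `Σ_k β_k(y)(h_k(y) - h_k(x)) ≤ d` for all
`x ∈ B`, `λ* ≤ β ≤ Λ*`, `m_k ≤ h_k ≤ M_k` on `B` with `m_l` the infimum of `h_l`: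
`(M_l - m_l) + 2N ≤ (1 + 1/λ* + Λ*/λ*) (d + N + Σ_k (M_k - h_k(y) + N))` for `y ∈ B`.
[cite: GilbargTrudinger2001, §17.4, (17.50)–(17.51)] -/
theorem osc_add_two_mul_le_pointwise {K : Type*} [Fintype K] [DecidableEq K] {E : Type*}
    {lamS ΛS : ℝ} (hlamS : 0 < lamS) (hΛS : lamS ≤ ΛS) {B : Set E} {h : K → E → ℝ}
    {M m : K → ℝ} (hMm : ∀ k, ∀ y ∈ B, m k ≤ h k y ∧ h k y ≤ M k) (l : K)
    (hml : ∀ t : ℝ, (∀ x ∈ B, t ≤ h l x) → t ≤ m l) {β : E → K → ℝ}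
    (hβ : ∀ y ∈ B, ∀ k, lamS ≤ β y k ∧ β y k ≤ ΛS) {d : ℝ} (hd : 0 ≤ d)
    (hcoup : ∀ x ∈ B, ∀ y ∈ B, ∑ k, β y k * (h k y - h k x) ≤ d) {N : ℝ} (hN : 0 ≤ N) {y : E}
    (hy : y ∈ B) :
    (M l - m l) + 2 * N ≤ (1 + 1 / lamS + ΛS / lamS) * (d + N + ∑ k, (M k - h k y + N)) := by
  set S₀ := ∑ k, (M k - h k y) with hS₀
  set S₁ := ∑ k, (M k - h k y + N) with hS₁
  have hterm0 : ∀ k, 0 ≤ M k - h k y := fun k ↦ sub_nonneg.2 (hMm k y hy).2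
  have hS₀0 : 0 ≤ S₀ := Finset.sum_nonneg fun k _ ↦ hterm0 k
  have hS₀1 : S₀ ≤ S₁ := Finset.sum_le_sum fun k _ ↦ by linarith
  have hRHS0 : 0 ≤ d + ΛS * S₀ := by have : 0 ≤ ΛS := hlamS.le.trans hΛS; positivity
  -- step 1: `λ* (h_l y - h_l x) ≤ d + Λ* S₀` for all `x ∈ B`
  have step1 : ∀ x ∈ B, lamS * (h l y - h l x) ≤ d + ΛS * S₀ := by
    intro x hx
    have hc := hcoup x hx y hy
    rw [← Finset.add_sum_erase Finset.univ _ (Finset.mem_univ l)] at hc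
    have hrest : -(ΛS * S₀) ≤ ∑ k ∈ Finset.univ.erase l, β y k * (h k y - h k x) := by
      have h1 : ∀ k, -(ΛS * (M k - h k y)) ≤ β y k * (h k y - h k x) := fun k ↦ by
        obtain ⟨hb1, hb2⟩ := hβ y hy k
        have := (hMm k x hx).2
        have := hterm0 k
        nlinarith
      have h2 : ∑ k ∈ Finset.univ.erase l, (M k - h k y) ≤ S₀ :=
        Finset.sum_le_sum_of_subset_of_nonneg (Finset.erase_subset _ _) fun k _ _ ↦ hterm0 k
      calc -(ΛS * S₀) ≤ -(ΛS * ∑ k ∈ Finset.univ.erase l, (M k - h k y)) := by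
            have : 0 ≤ ΛS := hlamS.le.trans hΛS
            nlinarith
        _ = ∑ k ∈ Finset.univ.erase l, -(ΛS * (M k - h k y)) := by
            rw [Finset.mul_sum, ← Finset.sum_neg_distrib]
        _ ≤ _ := Finset.sum_le_sum fun k _ ↦ h1 k
    have hβl : β y l * (h l y - h l x) ≤ d + ΛS * S₀ := by linarith
    obtain ⟨hb1, hb2⟩ := hβ y hy l
    rcases le_or_gt 0 (h l y - h l x) with hsgn | hsgn
    · calc lamS * (h l y - h l x) ≤ β y l * (h l y - h l x) :=
            mul_le_mul_of_nonneg_right hb1 hsgn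
        _ ≤ _ := hβl
    · have : lamS * (h l y - h l x) ≤ 0 := mul_nonpos_of_nonneg_of_nonpos hlamS.le hsgn.le
      linarith
  -- step 2: pass to the infimum
  have step2 : h l y - m l ≤ (d + ΛS * S₀) / lamS := by
    have h1 : h l y - (d + ΛS * S₀) / lamS ≤ m l := hml _ fun x hx ↦ by
      have h3 : h l y - h l x ≤ (d + ΛS * S₀) / lamS := by
        rw [le_div_iff₀ hlamS]; linarith [step1 x hx]
      linarith
    linarith
  -- step 3: add
  have step3 : M l - h l y + N ≤ S₁ :=
    Finset.single_le_sum (f := fun k ↦ M k - h k y + N) (fun k _ ↦ by linarith [hterm0 k])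
      (Finset.mem_univ l)
  have e1 : (d + ΛS * S₀) / lamS = (1 / lamS) * d + (ΛS / lamS) * S₀ := by
    field_simp
  rw [e1] at step2
  have hq : 0 ≤ ΛS / lamS := div_nonneg (hlamS.le.trans hΛS) hlamS.le
  have h4 := mul_le_mul_of_nonneg_left hS₀1 hq
  have expand : (1 + 1 / lamS + ΛS / lamS) * (d + N + S₁) =
      (S₁ + ((1 / lamS) * d + (ΛS / lamS) * S₁) + N) +
        (d + (1 / lamS) * N + (1 / lamS) * S₁ + (ΛS / lamS) * d + (ΛS / lamS) * N) := by ring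
  have hrest : 0 ≤ d + (1 / lamS) * N + (1 / lamS) * S₁ + (ΛS / lamS) * d + (ΛS / lamS) * N := by
    have : 0 ≤ S₁ := hS₀0.trans hS₀1
    positivity
  linarith

omit [DecidableEq ι] in
/-- `|B_r(y₀)| = rⁿ |B₁|` in `EuclideanSpace ℝ ι`, as real numbers. [folklore] -/
theorem volume_ball_toReal (y₀ : EuclideanSpace ℝ ι) {r : ℝ} (hr : 0 < r) :
    (volume (ball y₀ r)).toReal =
      r ^ Fintype.card ι * (volume (ball (0 : EuclideanSpace ℝ ι) 1)).toReal := by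
  rw [Measure.addHaar_ball_of_pos volume y₀ hr, finrank_euclideanSpace, ENNReal.toReal_mul,
    ENNReal.toReal_ofReal (pow_nonneg hr.le _)]

/-- The constants `δ = 1 - 1/(N₀ 2^{1/p} A)` with `N₀, A ≥ 1`, `0 < p`, lie in `(0,1)`.
[folklore] -/
theorem delta_mem_Ioo {p N₀ A : ℝ} (hp0 : 0 < p) (hN₀ : 1 ≤ N₀) (hA : 1 ≤ A) :
    0 < 1 - 1 / (N₀ * (2 : ℝ) ^ p⁻¹ * A) ∧ 1 - 1 / (N₀ * (2 : ℝ) ^ p⁻¹ * A) < 1 := by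
  have h2 : 1 < (2 : ℝ) ^ p⁻¹ := Real.one_lt_rpow one_lt_two (inv_pos.2 hp0)
  have hc0 : 0 < (2 : ℝ) ^ p⁻¹ := by positivity
  have hN₀0 : 0 < N₀ := by linarith
  have h3 : (2 : ℝ) ^ p⁻¹ ≤ N₀ * (2 : ℝ) ^ p⁻¹ := le_mul_of_one_le_left hc0.le hN₀
  have h4 : N₀ * (2 : ℝ) ^ p⁻¹ ≤ N₀ * (2 : ℝ) ^ p⁻¹ * A := le_mul_of_one_le_right (by positivity) hA
  have hprod : 1 < N₀ * (2 : ℝ) ^ p⁻¹ * A := lt_of_lt_of_le h2 (h3.trans h4)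
  constructor
  · rw [sub_pos, div_lt_one (by linarith)]; exact hprod
  · have : 0 < 1 / (N₀ * (2 : ℝ) ^ p⁻¹ * A) := by positivity
    linarith

/-- **The final bookkeeping** of GT p. 480: from
`((ω + 2N₀N)/N₀)^p ≤ c₁^p (d + N)^p + c₁^p Q (ω - ω_s + N₀(2εω + N))^p`, `N = g/λ + εω`,
take `p`-th roots and rearrange to `ω_s ≤ δ ω + C (εω + d + g)` with
`δ = 1 - 1/(N₀ 2^{1/p} A)`, `A = max(1, c₁ Q^{1/p})`, `C = (c₁ + 3N₀)(1 + 1/λ)`. [folklore] -/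
theorem oscillation_decay_algebra {p Q c₁ N₀ lam : ℝ} (hp0 : 0 < p) (hQ : 0 ≤ Q)
    (hc₁ : 1 ≤ c₁) (hN₀ : 1 ≤ N₀) (hlam : 0 < lam) {ω ωs ε d g N : ℝ} (hωs0 : 0 ≤ ωs)
    (hωs : ωs ≤ ω) (hε : 0 ≤ ε) (hd : 0 ≤ d) (hg : 0 ≤ g) (hN : N = g / lam + ε * ω)
    (hX : ((ω + 2 * N₀ * N) / N₀) ^ p ≤
      c₁ ^ p * (d + N) ^ p + c₁ ^ p * Q * (ω - ωs + N₀ * (2 * ε * ω + N)) ^ p) :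
    ωs ≤ (1 - 1 / (N₀ * (2 : ℝ) ^ p⁻¹ * max 1 (c₁ * Q ^ p⁻¹))) * ω +
      (c₁ + 3 * N₀) * (1 + 1 / lam) * (ε * ω + d + g) := by
  set A := max 1 (c₁ * Q ^ p⁻¹) with hA
  set c₃ := (2 : ℝ) ^ p⁻¹ with hc₃
  set Z := ω - ωs + N₀ * (2 * ε * ω + N) with hZ
  have hω0 : 0 ≤ ω := hωs0.trans hωs
  have hN0 : 0 ≤ N := by rw [hN]; positivity
  have hN₀0 : 0 < N₀ := by linarith
  have hZ0 : 0 ≤ Z := by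
    have : 0 ≤ N₀ * (2 * ε * ω + N) := by positivity
    rw [hZ]; linarith
  have hA1 : 1 ≤ A := le_max_left _ _
  have hA0 : 0 ≤ A := zero_le_one.trans hA1
  have hc₃0 : 0 < c₃ := Real.rpow_pos_of_pos two_pos _
  have hc₁0 : 0 ≤ c₁ := zero_le_one.trans hc₁
  -- `c₁^p Q ≤ A^p`
  have hApow : c₁ ^ p * Q ≤ A ^ p := by
    have h1 : c₁ * Q ^ p⁻¹ ≤ A := le_max_right _ _
    calc c₁ ^ p * Q = (c₁ * Q ^ p⁻¹) ^ p := by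
          rw [Real.mul_rpow hc₁0 (Real.rpow_nonneg hQ _), Real.rpow_inv_rpow hQ hp0.ne']
      _ ≤ A ^ p := Real.rpow_le_rpow (by positivity) h1 hp0.le
  have hX' : ((ω + 2 * N₀ * N) / N₀) ^ p ≤ c₁ ^ p * (d + N) ^ p + A ^ p * Z ^ p :=
    hX.trans (add_le_add le_rfl (mul_le_mul_of_nonneg_right hApow (Real.rpow_nonneg hZ0 _)))
  -- take `p`-th roots
  have hroot := le_of_rpow_le_add hp0 (by positivity) (by positivity) (by positivity) hX'
  rw [rpow_inv_mul_rpow hp0 hc₁0 (by positivity), rpow_inv_mul_rpow hp0 hA0 hZ0] at hroot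
  -- `hroot : (ω + 2N₀N)/N₀ ≤ c₃ (c₁ (d + N) + A Z)`
  have hmain : ω / N₀ ≤ c₃ * (c₁ * (d + N) + A * Z) := by
    have : ω / N₀ ≤ (ω + 2 * N₀ * N) / N₀ :=
      div_le_div_of_nonneg_right (by nlinarith) hN₀0.le
    exact this.trans hroot
  have hcA : 0 < c₃ * A := by positivity
  have hdiv : ω / (N₀ * c₃ * A) ≤ c₁ * (d + N) / A + Z := by
    have e1 : ω / (N₀ * c₃ * A) = ω / N₀ / (c₃ * A) := by rw [div_div, mul_assoc]
    have e2 : c₃ * (c₁ * (d + N) + A * Z) / (c₃ * A) = c₁ * (d + N) / A + Z := by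
      field_simp
    rw [e1, ← e2]
    exact div_le_div_of_nonneg_right hmain hcA.le
  have hdrop : c₁ * (d + N) / A ≤ c₁ * (d + N) := div_le_self (by positivity) hA1
  have key : c₁ * (d + N) + N₀ * (2 * ε * ω + N) ≤
      (c₁ + 3 * N₀) * (1 + 1 / lam) * (ε * ω + d + g) := by
    have e : (c₁ + 3 * N₀) * (1 + 1 / lam) * (ε * ω + d + g) -
        (c₁ * (d + N) + N₀ * (2 * ε * ω + N)) = 3 * N₀ * d + (c₁ + 3 * N₀) * g +
          (c₁ + 3 * N₀) * (ε * ω + d) / lam + 2 * N₀ * g / lam := by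
      rw [hN]; ring
    have : 0 ≤ 3 * N₀ * d + (c₁ + 3 * N₀) * g + (c₁ + 3 * N₀) * (ε * ω + d) / lam +
        2 * N₀ * g / lam := by positivity
    linarith
  have e3 : (1 - 1 / (N₀ * c₃ * A)) * ω = ω - ω / (N₀ * c₃ * A) := by ring
  rw [e3]
  rw [hZ] at hdiv
  linarith

end Literature.Analysis.PDE.EvansKrylov
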